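import Literature.MathematicalPhysics.QuantumFieldTheory.Balaban1983to89.B1Ineq229RegularRegion
import Literature.MathematicalPhysics.QuantumFieldTheory.Balaban1983to89.B1Prop23RegularRegion
import Literature.MathematicalPhysics.QuantumFieldTheory.Balaban1983to89.B2Ineq312OperatorNorm
import Literature.MathematicalPhysics.QuantumFieldTheory.Balaban1983to89.B2Sect2Statements

/-!
# `Balaban1983to89.B2Ineq2109HiggsLattice` — [Balaban1982Higgs2] **(2.108)–(2.109)** p. 580 ON THE (Higgs)₂,₃ CARRIER OF
# RECORD: the operator `H_k` of the *«difference between the quadratic forms»* built from the CONCRETE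
# `Δ^{(k),Lᵏε}(Ω, B̃) = B1Eq230FluctCov.deltaKA` of the typer's `HiggsLattice` tori at a (I.2.23)-REGULAR vector field `B̃ ≠ 0`,
# for the printed nested regions `Ω = Bᵏ(Λ₂^{(k−1)′}) ⊇ Ω₁ = Bᵏ(Λ₂^{(k−1)′} ∩ Λ₅^{(k)c})`, `Ω₂ = Bᵏ(Λ₂^{(k)})`; the splitting (2.108)
# EXACT; the FIRST inequality of (2.109) `|h_k(x,x′)| ≤ O(1)e^{−δ₁r(Lᵏε)}e^{−δ₀|x−x′|}` PROVED by the printed route *«using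
# Proposition I.2.2»* with Prop. I.2.2 (2.27)/(2.29) at `A ≠ 0` for regions DISCHARGED BY NAME (r14 gen 14:
# `B1Prop23RegularRegion.ineq227_regular_region_uniform`, `B1Ineq229RegularRegion.ineq229_regular_region`); the SECOND
# inequality; and the (3.8) ⇒ (3.12) operator-norm consequence for this `H_k` on the torus

statement-level skeleton of published theorems with citation tags; proofs where landed; nothing here is a claim about the Yang–Mills mass gap

PDF held: `paper:balaban1982-cmp86-higgs23-ii` (T. Bałaban, *(Higgs)₂,₃ quantum fields in a finite volume. II. An upper
bound*, Commun. Math. Phys. **86** (1982) 555–594, doi 10.1007/bf01214890 [Balaban1982Higgs2]; journal page = PDF page + 554);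
pp. 558, 576, 579–580, 584–586 [PDF 4, 22, 25–26, 30–32] READ AS IMAGES on the ×2 renders
`run/shared/lean/pub/pub-balaban/b2b-balaban-ref1/pages/1982-cmp86-higgs23-II/1982-cmp86-higgs23-II-p0NN-x2.png` (re-read by this
seat 2026-08-22); part I = [Balaban1982Higgs1] (`paper:balaban1982-cmp85-higgs23-i`, journal page = PDF page + 602) Prop. 2.2
(2.27)–(2.29) p. 611.

CITATION HEADER (lean-in-tree rule).  Cell `lit-balaban` (HOME `run/shared/lean/pub/lit-balaban/`), Phase-2 proof seat **p23**
gen 15 (unit `lit-balaban-p23-g15`; TAKING line HOME/STATUS.md 2026-08-22T09:45:10Z).  SKELETON row **B2.Eq2.109** ((2.108)–(2.109)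
p. 580; decl of record `…B2Sect2Statements.Ineq2109` = the FIRST inequality, r02, UNCHANGED; r14's twin predicate
`…B2StepK.KernelBound2109`, the second inequality `…B2StepK.kernelBound2109_pow_of_printed`, consumed BY NAME); head
`proved p260028` = this seat's gen-7 `B2Ineq2109RegularField` on the b04/p17 carrier (nested unions of unit blocks in `ℤ^{d+1}`,
transporters along block contours).  THIS FILE is the same statement ON THE CARRIER OF RECORD of the cell's concrete B1/B2 chain
(lead ruling 2026-08-20T22:40Z: the typer's `HiggsLattice` tori), where §3's (3.8)/(3.12) (r02 `B2Ineq312OperatorNorm`), Prop. 3.1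
(`B2Prop31*`), Lemma 2.3 (r14 `B2Lemma23HiggsLattice`) and Prop. 2.2 on `T_ε` (`B2Ineq258HiggsTorus`) already live; fold owner r02,
second reader r14, referee ref-4.  USED BY NAME, files untouched: typer `B1Eq230FluctCov.{deltaKA, mat, Ix}` (`Δ^{(k),Lᵏε}(Ω,A)` =
(I.2.21) solved form at a general field, its coordinate matrix), `HiggsAveraging.blockIter`, `HiggsLattice.Site.tdist` ((I.1.3));
r14 g14 `B1Prop23RegularRegion.ineq227_regular_region_uniform` ((I.2.27) at a regular `A` for a region `Ω = Bᵏ(Λ_k)`, constant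
uniform in the level) and `B1Ineq229RegularRegion.ineq229_regular_region` ((I.2.28)–(I.2.29) at a regular `A` for a nested pair,
ANY weight below the distance to the defect `Λ⁰_k ∖ Λ_k`); `B1Eq230FluctCovPos.siteInner_deltaKA_comm` + `B1Ineq234Concrete.mat_isSymm`
(symmetry of `Δ^{(k)}`); `B1Ineq234LevelZero.tdist_comm`; r14 `B2StepK.{KernelBound2109, kernelBound2109_pow_of_printed}`; r02
`B2Sect2Statements.Ineq2109`, `B2Ineq312OperatorNorm.norm312_le` ((3.8) ⇒ (3.12) on the torus, Schur test + volume-uniform sums).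

WHAT IS PRINTED (p. 580 [PDF 26], verbatim, render read as image).  *"Now we will transform the basic quadratic form in the
scalar fields and next we will do a translation in the field φ. We will localize this form in the set Λ₆^{(k−1)′}∩Λ₃^{(k)c},
Λ₃^{(k)}, and we will change the operators of the forms using Proposition I.2.2 and the restrictions on the fields ψ, φ. We
have ½aL^{d−2}Σ_{y∈T₁^{(k)′}}|ψ(y) − (Q(θ_kB̃)φ)(y)|² + ½⟨(Λ₆^{(k−1)′}∩Λ₃^{(k)c})φ, Δ^{(k)}(B^k(Λ₂^{(k−1)′}∩Λ₅^{(k)c}), B̃)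
(Λ₆^{(k−1)′}∩Λ₃^{(k)c})φ⟩ + ⟨(Λ₆^{(k−1)′}∩Λ₃^{(k)c})φ, Δ^{(k)}(B^k(Λ₂^{(k−1)′}∩Λ₅^{(k)c}), B̃)(Λ₃^{(k)}∩Λ₄^{(k)c})φ⟩ + ⟨Λ₃^{(k)}φ,
Δ^{(k)}(B^k(Λ₂^{(k)}), B^{(k+1),η})Λ₃^{(k)}φ⟩ + O((Lᵏε)^κ)|Λ₃^{(k)}|.  (2.108)  More exactly the difference between the quadratic
forms is a quadratic form ½⟨Λ₆^{(k−1)′}φ, H_kΛ₆^{(k−1)′}φ⟩ and for the matrix elements h_k(x, x′) of the operator H_k of this form,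
the following inequality holds |h_k(x, x′)| ≦ O(1)exp(−δ₁r(Lᵏε))exp(−δ₀|x − x′|) ≦ O((Lᵏε)^κ)exp(−δ₀|x − x′|)  (2.109)  for x,
x′ ∈ Λ₆^{(k−1)′} and arbitrary κ."*  (the fourth term is printed without the factor `½`; read corrected as in gen 7, cell GAPS.md
G-B2-08, kind = print.)  The basic quadratic form before the localization is `½⟨Λ₆^{(k−1)′}φ, Δ^{(k)}(B^k(Λ₂^{(k−1)′}), B̃)Λ₆^{(k−1)′}φ⟩`
((2.87) p. 575; p. 579: *"thus we have the propagator G_k(B^k(Λ₀^{(k)}), B̃) … this configuration satisfies the regularity assumption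
of Proposition I.2.1 on the basis of the estimate (2.98)"*); on `B^k(Λ₂^{(k)})` the field `B̃` of (2.93) EQUALS `B^{(k+1),η}` (p. 576,
`θ_{k+1} ≡ 1` there), so the fourth term of (2.108) is a change of DOMAIN only.  The sets: (2.7)–(2.8) p. 558, *"Λ_{i+1}^c is the
sum of all large blocks of T₁ with distances from the set Λ_i^c less or equal r(ε)"*, at scale `Lᵏε` (p. 566).  Part I, p. 611:
*"|Δ^{(k)}(Ω,A;x,x′)| ≤ c₀exp(−δ₀|x−x′|) (2.27) … |δΔ^{(k)}(Ω,Ω₀,A;x,x′)| ≤ c₀ exp(−δ₀(|x−x′| + dist(x,Ω^{(k)c}) + dist(x′,Ω^{(k)c})))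
(2.29)"*; p. 584 (3.8) and p. 586 (3.12): *"The property (3.8) implies in turn the following estimates for the norms of H′_k, H″_k in
L²(Λ₅⁽ᵏ⁾): ‖H′_k‖, ‖H″_k‖ ≦ O(1)exp(−δ₁r(Lᵏε)) ≦ O(1)(Lᵏε)^κ"*.

THE ARGUMENT (print gives the route, *«using Proposition I.2.2»*; the bookkeeping is the evident one, the same as gen 7's
`B2Ineq2109RegularField` §3–§4).  `Ω = B^k(Λ₂^{(k−1)′})`, `Ω₁ = B^k(Λ₂^{(k−1)′}∩Λ₅^{(k)c})`, `Ω₂ = B^k(Λ₂^{(k)})`,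
`P = Λ₆^{(k−1)′}∩Λ₃^{(k)c}`; `H_k` = `Λ₆′Δ^{(k)}(Ω,B̃)Λ₆′` minus the three localized operators of (2.108) (cross term symmetrized).
On `P × P`, `P × (Λ₃∖Λ₄)`, `(Λ₃∖Λ₄) × P` the entry is `−δΔ^{(k)}(Ω₁,Ω,B̃)(x,x′)` with both points `≥ r` from the defect `Λ₅^{(k)}`
((2.8): `dist(Λ₄ᶜ, Λ₅) > r`) — (I.2.29) with the weight `r` gives `c₀e^{−(δ/2)|x−x′|}e^{−δr}`; on `P × Λ₄`, `Λ₄ × P` nothing is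
subtracted and `|x − x′| ≥ r` ((2.8): `dist(Λ₃ᶜ, Λ₄) > r`) — (I.2.27) gives `c₀e^{−δ|x−x′|} ≤ c₀e^{−(δ/2)r}e^{−(δ/2)|x−x′|}`; on
`Λ₃ × Λ₃` the entry is `−δΔ^{(k)}(Ω₂,Ω,B̃)(x,x′)`, both points `≥ r` from the defect `Λ₂^{(k−1)′} ∖ Λ₂^{(k)}` (`dist(Λ₃^{(k)},
Λ₂^{(k)c}) > r`).  Hence (2.109)₁ with `O(1) = (c₀^{(2.27)} + c₀^{(2.29)})(Lᵏε)⁻²`, rates `δ/2` in `|x − x′|` and in `r`; all constants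
are functions of `(d, L, a)` (r14's), i.e. independent of `ε`, the torus, `k`, the regions and the field.

DICTIONARY (print ↦ Lean; the typer's `HiggsLattice` currency: `k = j + 1`, sites of `T^{(k)}_{Lᵏε}` = `HiggsLattice.Site P (j+1)`,
fine sites of `T_ε` = `HiggsLattice.Site P 0`, `x ∈ Bᵏ(y) ↔ blockIter (j+1) x = y`, `|x − x′|` = `tdist` in `Lᵏε`-units (I.1.3)).
`Inst`: `L2p ⊇ L6 ⊇ L3 ⊇ L4 ⊇ L5` ↤ `Λ₂^{(k−1)′} ⊇ Λ₆^{(k−1)′} ⊇ Λ₃^{(k)} ⊇ Λ₄^{(k)} ⊇ Λ₅^{(k)}` (sets of `k`-sites: the primed sets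
are `Λ ∩ T^{(k)}` by (I.1.16)); `L2k` ↤ `Λ₂^{(k)}` (`L3 ⊆ L2k ⊆ L2p`); `A` ↤ `B̃`; `C` ↤ the charge data `(e, q)` of (I.1.7), `e` =
`e(Lᵏε)`; `msq` ↤ the mass of `Δ^{(k)}`; the family parameter `a` ↤ `a` of (I.2.16) (`a_k = B1.aSeq a L k ≤ a`, inside `coeff221`);
`dA` ↤ the one-step difference bound of the lattice form of (I.2.23); `r` ↤ `r(Lᵏε)`.  `Ω/Ω₁/Ω₂` = the fine regions (`reg`), `DΩ/D1/D2`
= entries of `mat (deltaKA C Ω A m² a k)` etc. on `X = ↥L6 × Ix N` ↤ `Λ₆^{(k−1)′} × {1,…,N}`; `MΩ, MPP, MP34, M34P, M33` ↤ the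
matrices of the full form and of the three localized forms; **`Hk := MΩ − MPP − MP34 − M34P − M33`** ↤ `H_k`; `hk p q` ↤ `h_k(x,x′)`.
CURRENCY NOTE ((I.2.22) p. 610): print states (2.109) for the operator on the UNIT lattice `T₁^{(k)}`; the typer's `deltaKA … (j+1)` is
`Δ^{(k),Lᵏε}` in `Lᵏε`-units and carries the factor `(Lᵏε)⁻²` (as in r14's (2.27)/(2.29) theorems) — the unit-lattice kernel is
`hkUnit = (Lᵏε)²·hk`, for which the printed shape holds with `ε`-free constants (`abs_hkUnit_le`, `ineq2109_higgsLattice`).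
`Adm a i` ↤ the standing context: (I.2.23)-regularity of `B̃` on `Ω` in r14's lattice form with its coupling smallness (*"for e(Lᵏε)
sufficiently small"*), `r ≥ 0`, the (2.8) separations `sep45/sep34/sep2k`.

WHAT IS KERNEL-CHECKED (zero `sorry`, no new `def … : Prop` fact; axioms standard).
 §1 `Inst`, `reg`/`mem_reg`, `Ω/Ω₁/Ω₂`; §2 the matrices, **`Hk`**, **`eq2108_split`** (exact), `D1_comm`, `M34P_eq_transpose`,
    `form_M34P_eq`, **`eq2108_split_printed`** (cross term once), block formulas `hk_PP/hk_P34/hk_P4/hk_34P/hk_4P/hk_33`;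
 §3 `Adm`, the weights `w1/w2` (admissible for r14's general-weight (I.2.29)), **`Inst.abs_hk_le`** = (2.109)₁ POINTWISE with the
    explicit constant `(c227 + c229)(Lᵏε)⁻²` and rates `δ/2`, for every `δ ≥ 0` with `(4d + 4a)δ ≤ γ₀ = min{2, a(1 − L⁻²)/4}`;
    `abs_hkUnit_le` (unit-lattice currency);
 §4 the printed quantifier shape **`ineq2109_higgsLattice_explicit`** (`∀ d, L > 1, a > 0 ∃ C, δ₀, δ₁ > 0` BEFORE the torus, `N`, charge,
    mass, level, regions, field), **`ineq2109_higgsLattice : B2Sect2Statements.Ineq2109 …`** (THE ROW'S DECL INHABITED for the family of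
    all admissible carrier instances, unit-lattice kernel), `kernelBound2109_higgsLattice` (r14's twin), **`ineq2109_pow_higgsLattice`**
    (second inequality, printed ranges, `r = r(Lᵏε)`, `0 < Lᵏε ≤ 1`);
 §5 **`norm_Hk_le`** = (3.8) ⇒ (3.12) FOR THIS `H_k`: `‖H_k‖_{L²} ≤ C(Lᵏε)⁻²·N·K_d(δ₀)·e^{−δ₁r}` (r02's `norm312_le` fed with §4);
    `adm_nonvacuous` (the admissible family is inhabited on every torus: `B̃ = 0`).

HONEST SCOPE.  (a) CARRIER: the typer's `HiggsLattice` tori (every `d, L > 1`, volume, `ε`, `K`), the concrete `deltaKA` at level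
`k = j+1 ≤ K` with `m² > 0` (invertibility), any `N`, any charge data; `B̃` is ANY field regular on `Ω` in r14's lattice form of
(I.2.23) with the smallness `d²·ε|e|·L^{2k}·δ_A ≤ 1/3` — that the actual `B̃` of (2.93) is regular is the printed (2.94)–(2.98), NOT
re-derived here; that `B̃ = B^{(k+1),η}` on `B^k(Λ₂^{(k)})` is read off (2.93) and is why `D2` carries the same field.  (b) The (2.8)
separations and the nesting enter as HYPOTHESES on abstract finite sets of `k`-sites (`Adm.sep45/sep34/sep2k`, `Inst.h6…h2k`) —
consequences of the construction (2.7)–(2.8) (cf. typer `B2Eq243RegionsTower`, this seat's gen-13 `B2Eq28RegionsCollars`), with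
`r ≤ |x − u|` where print has `>` (weaker hypothesis); «unions of big blocks» is NOT needed by r14's route (energy comparison +
Combes–Thomas, not the printed random walk) and is not assumed.  (c) The weights of r14's (I.2.29) are distances to the DEFECT
`Λ⁰_k ∖ Λ_k` (the Dirichlet-decoupling reading of `dist(·, Ω^{(k)c})`, as in b04/p17 and gen 7).  (d) Constants explicit and crude
(r14's); `(2.109)₂` and (3.12) need `0 < Lᵏε ≤ 1` and the printed ranges of (2.7).  (e) The `O((Lᵏε)^κ)|Λ₃^{(k)}|` SIZE of the
`H_k`-form in (2.108) is not in this file (gen 7's `B2Eq2108ErrorBound` on the b04 carrier; carrier port = a sibling file).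
(f) Value = the B2.Eq2.109 statement now holds on the carrier of record, consuming the B1 lane's regular-region theorems by
name; NOT summit progress.
-/

noncomputable section

open scoped BigOperators Matrix

namespace Literature.MathematicalPhysics.QuantumFieldTheory.Balaban1983to89.B2Ineq2109HiggsLattice

open HiggsLattice HiggsAveraging HiggsCovariance B1Eq230FluctCov
open B1Prop23RegularRegion (ineq227_regular_region_uniform)
open B1Ineq229RegularRegion (ineq229_regular_region)
open B1Eq230FluctCovPos (siteInner_deltaKA_comm)
open B1Ineq234Concrete (mat_isSymm)
open B1Ineq234LevelZero (tdist_comm)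
open Matrix

variable {P : HiggsLattice.Params} {N : ℕ}

/-! ## §1 One step of (2.108) on the (Higgs)₂,₃ carrier: the sets, the regions -/

/-- The data of one step `k = j + 1` of (2.108) on a `HiggsLattice` torus: the charge data and the field `B̃` of the scalar
forms, the mass, the regularity modulus `δ_A` of (I.2.23) (lattice form), the sets of `k`-sites `L2p ⊇ L6 ⊇ L3 ⊇ L4 ⊇ L5`
(↤ `Λ₂^{(k−1)′} ⊇ Λ₆^{(k−1)′} ⊇ Λ₃^{(k)} ⊇ Λ₄^{(k)} ⊇ Λ₅^{(k)}`) and `L2k` (↤ `Λ₂^{(k)}`, `Λ₃^{(k)} ⊆ Λ₂^{(k)} ⊆ Λ₂^{(k−1)′}`), and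
`r` ↤ `r(Lᵏε)`. [cite: Balaban1982Higgs2, (2.108) p.580, (2.7)–(2.8) p.558] -/
structure Inst (P : HiggsLattice.Params) (N : ℕ) where
  j : ℕ
  hjK : j + 1 ≤ P.K
  C : ChargeData N
  A : HiggsLattice.VecField P 0
  msq : ℝ
  hmsq : 0 < msq
  dA : ℝ
  L2p : Finset (HiggsLattice.Site P (j + 1))
  L6 : Finset (HiggsLattice.Site P (j + 1))
  L3 : Finset (HiggsLattice.Site P (j + 1))
  L4 : Finset (HiggsLattice.Site P (j + 1))
  L5 : Finset (HiggsLattice.Site P (j + 1))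
  L2k : Finset (HiggsLattice.Site P (j + 1))
  h6 : L6 ⊆ L2p
  h36 : L3 ⊆ L6
  h43 : L4 ⊆ L3
  h54 : L5 ⊆ L4
  h32 : L3 ⊆ L2k
  h2k : L2k ⊆ L2p
  r : ℝ

namespace Inst

variable (i : Inst P N)

/-- `Bᵏ(S)`: the fine sites of `T_ε` whose `k`-block label lies in `S` ((I.1.18) iterated, (I.2.2)). [cite: Balaban1982Higgs1, (1.18) p.607] -/
def reg (S : Finset (HiggsLattice.Site P (i.j + 1))) : Finset (HiggsLattice.Site P 0) :=
  Finset.univ.filter fun x => blockIter (i.j + 1) x ∈ S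

/-- `x ∈ Bᵏ(S) ↔ x_k ∈ S`. [cite: Balaban1982Higgs1, (1.18) p.607] -/
theorem mem_reg (S : Finset (HiggsLattice.Site P (i.j + 1))) (x : HiggsLattice.Site P 0) :
    x ∈ i.reg S ↔ blockIter (i.j + 1) x ∈ S := by
  simp [reg]

/-- `Ω = Bᵏ(Λ₂^{(k−1)′})`, the region of the basic quadratic form (2.87)/(2.108). [cite: Balaban1982Higgs2, (2.108) p.580] -/
abbrev Ω : Finset (HiggsLattice.Site P 0) := i.reg i.L2p

/-- `Ω₁ = Bᵏ(Λ₂^{(k−1)′} ∩ Λ₅^{(k)c})`. [cite: Balaban1982Higgs2, (2.108) p.580] -/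
abbrev Ω₁ : Finset (HiggsLattice.Site P 0) := i.reg (i.L2p \ i.L5)

/-- `Ω₂ = Bᵏ(Λ₂^{(k)})`. [cite: Balaban1982Higgs2, (2.108) p.580] -/
abbrev Ω₂ : Finset (HiggsLattice.Site P 0) := i.reg i.L2k

/-! ## §2 The matrices of (2.108) and `H_k` -/

variable (a : ℝ)

/-- the kernel of `Λ₆′Δ^{(k)}(Ω,B̃)Λ₆′` on `X = Λ₆^{(k−1)′} × {1,…,N}` (entries of the typer's coordinate matrix of
`Δ^{(k),Lᵏε}(Ω,B̃)`). [cite: Balaban1982Higgs2, (2.108) p.580; Balaban1982Higgs1, (2.21) p.610] -/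
def DΩ (p q : ↥i.L6 × Ix N) : ℝ := mat (deltaKA i.C i.Ω i.A i.msq a (i.j + 1)) (p.1.1, p.2) (q.1.1, q.2)

/-- the kernel of `Δ^{(k)}(Ω₁,B̃)` read on `X`. [cite: Balaban1982Higgs2, (2.108) p.580] -/
def D1 (p q : ↥i.L6 × Ix N) : ℝ := mat (deltaKA i.C i.Ω₁ i.A i.msq a (i.j + 1)) (p.1.1, p.2) (q.1.1, q.2)

/-- the kernel of `Δ^{(k)}(Ω₂,B^{(k+1),η})` read on `X` — on `Ω₂` the field `B̃` of (2.93) IS `B^{(k+1),η}` (`θ_{k+1} ≡ 1` there,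
p. 576), so this is the instance's field again. [cite: Balaban1982Higgs2, (2.108) p.580, (2.93) p.576] -/
def D2 (p q : ↥i.L6 × Ix N) : ℝ := mat (deltaKA i.C i.Ω₂ i.A i.msq a (i.j + 1)) (p.1.1, p.2) (q.1.1, q.2)

/-- the full form's matrix `Λ₆′Δ^{(k)}(Bᵏ(Λ₂^{(k−1)′}),B̃)Λ₆′` on `X`. [cite: Balaban1982Higgs2, (2.108) p.580] -/
def MΩ : Matrix (↥i.L6 × Ix N) (↥i.L6 × Ix N) ℝ := Matrix.of (i.DΩ a)

/-- second term of (2.108): `(Λ₆′∩Λ₃ᶜ)Δ^{(k)}(Ω₁,B̃)(Λ₆′∩Λ₃ᶜ)`. [cite: Balaban1982Higgs2, (2.108) p.580] -/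
def MPP : Matrix (↥i.L6 × Ix N) (↥i.L6 × Ix N) ℝ :=
  Matrix.of fun p q => if p.1.1 ∉ i.L3 ∧ q.1.1 ∉ i.L3 then i.D1 a p q else 0

/-- third term of (2.108), right half: `(Λ₆′∩Λ₃ᶜ)Δ^{(k)}(Ω₁,B̃)(Λ₃∩Λ₄ᶜ)`. [cite: Balaban1982Higgs2, (2.108) p.580] -/
def MP34 : Matrix (↥i.L6 × Ix N) (↥i.L6 × Ix N) ℝ :=
  Matrix.of fun p q => if p.1.1 ∉ i.L3 ∧ (q.1.1 ∈ i.L3 ∧ q.1.1 ∉ i.L4) then i.D1 a p q else 0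

/-- third term of (2.108), left half (the form is symmetric; print writes the cross term once, without `½`):
`(Λ₃∩Λ₄ᶜ)Δ^{(k)}(Ω₁,B̃)(Λ₆′∩Λ₃ᶜ)`. [cite: Balaban1982Higgs2, (2.108) p.580] -/
def M34P : Matrix (↥i.L6 × Ix N) (↥i.L6 × Ix N) ℝ :=
  Matrix.of fun p q => if (p.1.1 ∈ i.L3 ∧ p.1.1 ∉ i.L4) ∧ q.1.1 ∉ i.L3 then i.D1 a p q else 0

/-- fourth term of (2.108): `Λ₃Δ^{(k)}(Bᵏ(Λ₂^{(k)}),B^{(k+1),η})Λ₃`. [cite: Balaban1982Higgs2, (2.108) p.580] -/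
def M33 : Matrix (↥i.L6 × Ix N) (↥i.L6 × Ix N) ℝ :=
  Matrix.of fun p q => if p.1.1 ∈ i.L3 ∧ q.1.1 ∈ i.L3 then i.D2 a p q else 0

/-- **`H_k`** p. 580: *"More exactly the difference between the quadratic forms is a quadratic form ½⟨Λ₆^{(k−1)′}φ,
H_kΛ₆^{(k−1)′}φ⟩"* — the matrix of `Λ₆′Δ^{(k)}(Bᵏ(Λ₂^{(k−1)′}),B̃)Λ₆′` MINUS the matrices of the three localized forms of (2.108),
for the CONCRETE `Δ^{(k),Lᵏε}` of the carrier. [cite: Balaban1982Higgs2, (2.108)–(2.109) p.580] -/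
def Hk : Matrix (↥i.L6 × Ix N) (↥i.L6 × Ix N) ℝ := i.MΩ a - i.MPP a - i.MP34 a - i.M34P a - i.M33 a

/-- `h_k(x,x′)`: the matrix elements of `H_k` (in `Lᵏε`-units, i.e. carrying `(Lᵏε)⁻²`). [cite: Balaban1982Higgs2, (2.109) p.580] -/
abbrev hk (p q : ↥i.L6 × Ix N) : ℝ := i.Hk a p q

/-- `h_k(x,x′)` in the printed UNIT-LATTICE currency of `T₁^{(k)}` ((I.2.22): `Δ^{(k)} = (Lᵏε)²·Δ^{(k),Lᵏε}`).
[cite: Balaban1982Higgs2, (2.109) p.580; Balaban1982Higgs1, (2.22) p.610] -/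
def hkUnit (p q : ↥i.L6 × Ix N) : ℝ := P.mesh (i.j + 1) ^ 2 * i.hk a p q

/-- **(2.108), the splitting, EXACTLY**: `⟨Λ₆′φ, Δ^{(k)}(Ω,B̃)Λ₆′φ⟩ = ⟨Pφ, Δ^{(k)}(Ω₁,B̃)Pφ⟩ + (⟨Pφ, Δ^{(k)}(Ω₁,B̃)(Λ₃∩Λ₄ᶜ)φ⟩ +
⟨(Λ₃∩Λ₄ᶜ)φ, Δ^{(k)}(Ω₁,B̃)Pφ⟩) + ⟨Λ₃φ, Δ^{(k)}(Ω₂,B^{(k+1),η})Λ₃φ⟩ + ⟨Λ₆′φ, H_kΛ₆′φ⟩`, `P = Λ₆^{(k−1)′} ∩ Λ₃^{(k)c}` (coordinate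
dot products; halve for the printed `½`'s). [cite: Balaban1982Higgs2, (2.108) p.580] -/
theorem eq2108_split (φ : ↥i.L6 × Ix N → ℝ) :
    φ ⬝ᵥ (i.MΩ a *ᵥ φ) = φ ⬝ᵥ (i.MPP a *ᵥ φ) + (φ ⬝ᵥ (i.MP34 a *ᵥ φ) + φ ⬝ᵥ (i.M34P a *ᵥ φ))
      + φ ⬝ᵥ (i.M33 a *ᵥ φ) + φ ⬝ᵥ (i.Hk a *ᵥ φ) := by
  simp only [Hk, Matrix.sub_mulVec, dotProduct_sub]
  ring

/-! ### symmetry: the two halves of the cross term of (2.108) agree -/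

/-- `Δ^{(k),Lᵏε}(Ω,A)` has a symmetric coordinate matrix (symmetric for (I.1.5): typer `siteInner_deltaKA_comm`).
[cite: Balaban1982Higgs1, (2.21) p.610] -/
theorem mat_deltaKA_symm (C : ChargeData N) (Ω : Finset (HiggsLattice.Site P 0)) (A : HiggsLattice.VecField P 0)
    (msq a : ℝ) (j : ℕ) (p q : HiggsLattice.Site P j × Ix N) :
    mat (deltaKA C Ω A msq a j) q p = mat (deltaKA C Ω A msq a j) p q :=
  (mat_isSymm (siteInner_deltaKA_comm C Ω A msq a j)).apply p q

/-- the `Ω₁`-kernel read on `X` is symmetric. [cite: Balaban1982Higgs2, (2.108) p.580] -/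
theorem D1_comm (p q : ↥i.L6 × Ix N) : i.D1 a p q = i.D1 a q p := by
  unfold D1
  exact (mat_deltaKA_symm _ _ _ _ _ _ _ _).symm

/-- the left half of the cross term is the transpose of the right half. [cite: Balaban1982Higgs2, (2.108) p.580] -/
theorem M34P_eq_transpose : i.M34P a = (i.MP34 a)ᵀ := by
  ext p q
  simp only [M34P, MP34, Matrix.transpose_apply, Matrix.of_apply]
  by_cases h : (p.1.1 ∈ i.L3 ∧ p.1.1 ∉ i.L4) ∧ q.1.1 ∉ i.L3
  · rw [if_pos h, if_pos ⟨h.2, h.1⟩, D1_comm]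
  · have h' : ¬(q.1.1 ∉ i.L3 ∧ (p.1.1 ∈ i.L3 ∧ p.1.1 ∉ i.L4)) := fun h2 => h ⟨h2.2, h2.1⟩
    rw [if_neg h, if_neg h']

/-- **the two cross halves of (2.108) are EQUAL** (so their sum is the printed `⟨(Λ₆′∩Λ₃ᶜ)φ, Δ^{(k)}(Ω₁,B̃)(Λ₃∩Λ₄ᶜ)φ⟩`
written once without `½`). [cite: Balaban1982Higgs2, (2.108) p.580] -/
theorem form_M34P_eq (φ : ↥i.L6 × Ix N → ℝ) : φ ⬝ᵥ (i.M34P a *ᵥ φ) = φ ⬝ᵥ (i.MP34 a *ᵥ φ) := by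
  rw [M34P_eq_transpose, Matrix.mulVec_transpose, dotProduct_comm, ← Matrix.dotProduct_mulVec]

/-- (2.108) with the cross term written once, as printed: `⟨Λ₆′φ,Δ(Ω)Λ₆′φ⟩ = ⟨Pφ,Δ(Ω₁)Pφ⟩ + 2⟨Pφ,Δ(Ω₁)(Λ₃∖Λ₄)φ⟩ +
⟨Λ₃φ,Δ(Ω₂)Λ₃φ⟩ + ⟨Λ₆′φ,H_kΛ₆′φ⟩` (halve for the printed `½`'s). [cite: Balaban1982Higgs2, (2.108) p.580] -/
theorem eq2108_split_printed (φ : ↥i.L6 × Ix N → ℝ) :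
    φ ⬝ᵥ (i.MΩ a *ᵥ φ) = φ ⬝ᵥ (i.MPP a *ᵥ φ) + 2 * (φ ⬝ᵥ (i.MP34 a *ᵥ φ))
      + φ ⬝ᵥ (i.M33 a *ᵥ φ) + φ ⬝ᵥ (i.Hk a *ᵥ φ) := by
  rw [eq2108_split, form_M34P_eq]
  ring

/-! ### the matrix elements of `H_k` block by block -/

section Blocks

variable {i a}

/-- block `P × P`: `h_k = Δ(Ω) − Δ(Ω₁) = −δΔ^{(k)}(Ω₁,Ω,B̃)`. [cite: Balaban1982Higgs2, (2.108) p.580] -/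
theorem hk_PP {p q : ↥i.L6 × Ix N} (hp : p.1.1 ∉ i.L3) (hq : q.1.1 ∉ i.L3) :
    i.hk a p q = i.DΩ a p q - i.D1 a p q := by
  have hq4 : q.1.1 ∉ i.L4 := fun h => hq (i.h43 h)
  simp [hk, Hk, MΩ, MPP, MP34, M34P, M33, hp, hq]

/-- block `P × (Λ₃∩Λ₄ᶜ)`: `h_k = Δ(Ω) − Δ(Ω₁)`. [cite: Balaban1982Higgs2, (2.108) p.580] -/
theorem hk_P34 {p q : ↥i.L6 × Ix N} (hp : p.1.1 ∉ i.L3) (hq3 : q.1.1 ∈ i.L3) (hq4 : q.1.1 ∉ i.L4) :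
    i.hk a p q = i.DΩ a p q - i.D1 a p q := by
  simp [hk, Hk, MΩ, MPP, MP34, M34P, M33, hp, hq3, hq4]

/-- block `P × Λ₄`: nothing is subtracted, `h_k = Δ^{(k)}(Ω,B̃)(x,x′)` at `|x − x′| ≥ r`. [cite: Balaban1982Higgs2, (2.108) p.580] -/
theorem hk_P4 {p q : ↥i.L6 × Ix N} (hp : p.1.1 ∉ i.L3) (hq4 : q.1.1 ∈ i.L4) :
    i.hk a p q = i.DΩ a p q := by
  have hq3 : q.1.1 ∈ i.L3 := i.h43 hq4
  simp [hk, Hk, MΩ, MPP, MP34, M34P, M33, hp, hq3, hq4]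

/-- block `(Λ₃∩Λ₄ᶜ) × P`: `h_k = Δ(Ω) − Δ(Ω₁)`. [cite: Balaban1982Higgs2, (2.108) p.580] -/
theorem hk_34P {p q : ↥i.L6 × Ix N} (hp3 : p.1.1 ∈ i.L3) (hp4 : p.1.1 ∉ i.L4) (hq : q.1.1 ∉ i.L3) :
    i.hk a p q = i.DΩ a p q - i.D1 a p q := by
  simp [hk, Hk, MΩ, MPP, MP34, M34P, M33, hp3, hp4, hq]

/-- block `Λ₄ × P`: `h_k = Δ^{(k)}(Ω,B̃)(x,x′)`. [cite: Balaban1982Higgs2, (2.108) p.580] -/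
theorem hk_4P {p q : ↥i.L6 × Ix N} (hp4 : p.1.1 ∈ i.L4) (hq : q.1.1 ∉ i.L3) :
    i.hk a p q = i.DΩ a p q := by
  have hp3 : p.1.1 ∈ i.L3 := i.h43 hp4
  simp [hk, Hk, MΩ, MPP, MP34, M34P, M33, hp3, hp4, hq]

/-- block `Λ₃ × Λ₃`: `h_k = Δ(Ω,B̃) − Δ(Ω₂,B^{(k+1),η}) = −δΔ^{(k)}(Ω₂,Ω,B̃)`. [cite: Balaban1982Higgs2, (2.108) p.580] -/
theorem hk_33 {p q : ↥i.L6 × Ix N} (hp3 : p.1.1 ∈ i.L3) (hq3 : q.1.1 ∈ i.L3) :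
    i.hk a p q = i.DΩ a p q - i.D2 a p q := by
  simp [hk, Hk, MΩ, MPP, MP34, M34P, M33, hp3, hq3]

end Blocks

end Inst

/-! ## §3 (2.109), the FIRST inequality, by the printed route «using Proposition I.2.2»

The standing context of the step — regularity (I.2.23) of `B̃` on `Ω` in r14's lattice form with the coupling smallness of
r14's Cor. 2.3 for regions, `r ≥ 0`, and the separations (2.8) of the sets — is collected in `Adm`.
[cite: Balaban1982Higgs2, (2.108)–(2.109) p.580, (2.93)–(2.98) pp.576–577, (2.8) p.558] -/

/-- The standing context of the step `k` for the instance `i` (family parameter `a` of (I.2.16)): `reg` ↤ *"this configuration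
satisfies the regularity assumption of Proposition I.2.1"* (p. 579; (2.94)–(2.98)), in r14's lattice form of (I.2.23) on `Ω`:
`|B̃_μ(z + εe_ν) − B̃_μ(z)| ≤ δ_A`, `z ∈ Ω`; `small` ↤ *"for e(Lᵏε) sufficiently small"* (r14's threshold `d²·ε|e|·L^{2k}·δ_A ≤ 1/3`);
`hr` ↤ `r(Lᵏε) ≥ 0`; `sep45/sep34/sep2k` ↤ the construction (2.8) p. 558 (*"Λ_{i+1}^c is the sum of all large blocks of T₁ with
distances from the set Λ_i^c less or equal r(ε)"*, at scale `Lᵏε`): points of `Λ₅^{(k)}` are `≥ r` away from `Λ₄^{(k)c}`, points of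
`Λ₄^{(k)}` from `Λ₃^{(k)c}`, points of `Λ₃^{(k)}` from `Λ₂^{(k)c}` (torus distance (I.1.3) of `k`-sites, in `Lᵏε`-units; `≥` where print
has `>`). [cite: Balaban1982Higgs2, (2.108)–(2.109) p.580, (2.8) p.558] -/
structure Adm (a : ℝ) (i : Inst P N) : Prop where
  reg : ∀ z ∈ i.Ω, ∀ μ ν : Fin P.d, |i.A ⟨z.shift ν, μ⟩ - i.A ⟨z, μ⟩| ≤ i.dA
  small : (P.d : ℝ) ^ 2 * (P.mesh 0 * |i.C.e|) * ((P.L : ℝ) ^ (i.j + 1)) ^ 2 * i.dA ≤ 1 / 3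
  hr : 0 ≤ i.r
  sep45 : ∀ y ∈ i.L6, y ∉ i.L4 → ∀ u ∈ i.L5, i.r ≤ (HiggsLattice.Site.tdist y u : ℝ)
  sep34 : ∀ y ∈ i.L6, y ∉ i.L3 → ∀ u ∈ i.L4, i.r ≤ (HiggsLattice.Site.tdist y u : ℝ)
  sep2k : ∀ y ∈ i.L3, ∀ u ∈ i.L2p, u ∉ i.L2k → i.r ≤ (HiggsLattice.Site.tdist y u : ℝ)

/-- r14's `γ₀ = min{2, a(1 − L⁻²)/4}` (the coercivity constant of Cor. 2.3 for regions). [cite: Balaban1982Higgs1, (2.27) p.611] -/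
def gam (L : ℕ) (a : ℝ) : ℝ := min 2 (a * (1 - ((L : ℝ) ^ 2)⁻¹) / 4)

/-- r14's constant of (I.2.27) at a regular field for regions, unit-lattice currency: `c₀ = a + a²(2/γ₀)e^{δ}`.
[cite: Balaban1982Higgs1, (2.27) p.611] -/
def c227 (L : ℕ) (a δ : ℝ) : ℝ := a + a ^ 2 * (2 / gam L a * Real.exp δ)

/-- r14's constant of (I.2.29) at a regular field for nested regions, unit-lattice currency: `a²·½(K₁ + K₂)`.
[cite: Balaban1982Higgs1, (2.29) p.611] -/
def c229 (d L : ℕ) (a δ : ℝ) : ℝ :=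
  a ^ 2 * ((Real.exp (6 * δ) * (((d : ℝ) + a / 2) * (2 / gam L a) ^ 2 + (gam L a)⁻¹) + 4 / gam L a * Real.exp δ) / 2)

/-- `γ₀ > 0` for `a > 0`, `L > 1`. [cite: Balaban1982Higgs1, (2.27) p.611] -/
theorem gam_pos {L : ℕ} (hL : 1 < L) {a : ℝ} (ha : 0 < a) : 0 < gam L a := by
  have hL' : (1 : ℝ) < (L : ℝ) := by exact_mod_cast hL
  have hinv : ((L : ℝ) ^ 2)⁻¹ < 1 := inv_lt_one_of_one_lt₀ (by nlinarith)
  exact lt_min (by norm_num) (by nlinarith [mul_pos ha (show (0:ℝ) < 1 - ((L : ℝ) ^ 2)⁻¹ by linarith)])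

/-- `c₀^{(2.27)} ≥ 0`. [cite: Balaban1982Higgs1, (2.27) p.611] -/
theorem c227_nonneg {L : ℕ} (hL : 1 < L) {a : ℝ} (ha : 0 < a) (δ : ℝ) : 0 ≤ c227 L a δ := by
  have := gam_pos hL ha
  unfold c227
  positivity

/-- `c₀^{(2.29)} ≥ 0`. [cite: Balaban1982Higgs1, (2.29) p.611] -/
theorem c229_nonneg (d : ℕ) {L : ℕ} (hL : 1 < L) {a : ℝ} (ha : 0 < a) (δ : ℝ) : 0 ≤ c229 d L a δ := by
  have := gam_pos hL ha
  unfold c229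
  positivity

section Arith

/-- the far bound: `e^{−δD} ≤ e^{−(δ/2)r}·e^{−(δ/2)D}` for `D ≥ r`, `δ ≥ 0`. [cite: Balaban1982Higgs2, (2.109) p.580] -/
private theorem far_le {δ D r : ℝ} (hδ : 0 ≤ δ) (hD : r ≤ D) :
    Real.exp (-(δ * D)) ≤ Real.exp (-(δ / 2 * r)) * Real.exp (-(δ / 2 * D)) := by
  rw [← Real.exp_add]
  refine Real.exp_le_exp.2 ?_
  nlinarith [mul_le_mul_of_nonneg_left hD hδ]

/-- the doubly-damped bound: `e^{−(δ/2)(D + r + r)} ≤ e^{−(δ/2)r}·e^{−(δ/2)D}` for `δ, r ≥ 0`. [cite: Balaban1982Higgs2, (2.109) p.580] -/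
private theorem damped_le {δ D r : ℝ} (hδ : 0 ≤ δ) (hr : 0 ≤ r) :
    Real.exp (-(δ / 2 * (D + r + r))) ≤ Real.exp (-(δ / 2 * r)) * Real.exp (-(δ / 2 * D)) := by
  rw [← Real.exp_add]
  refine Real.exp_le_exp.2 ?_
  nlinarith [mul_nonneg hδ hr]

end Arith

namespace Inst

variable {a : ℝ} (i : Inst P N)

/-- the weight of the pair `Ω₁ ⊆ Ω` for r14's (I.2.29): `r` on `Λ₆′ ∖ Λ₄`, `0` elsewhere — admissible (below the distance to the
defect `Λ₅^{(k)}`) by `sep45`. [cite: Balaban1982Higgs2, (2.8) p.558] -/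
def w1 : HiggsLattice.Site P (i.j + 1) → ℝ := fun y => if y ∈ i.L6 ∧ y ∉ i.L4 then i.r else 0

/-- the weight of the pair `Ω₂ ⊆ Ω`: `r` on `Λ₃^{(k)}`, `0` elsewhere — admissible (below the distance to the defect
`Λ₂^{(k−1)′} ∖ Λ₂^{(k)}`) by `sep2k`. [cite: Balaban1982Higgs2, (2.8) p.558] -/
def w2 : HiggsLattice.Site P (i.j + 1) → ℝ := fun y => if y ∈ i.L3 then i.r else 0

variable {i}

/-- `w1` is an admissible weight for the pair `(Λ₂′ ∖ Λ₅) ⊆ Λ₂′`. [cite: Balaban1982Higgs2, (2.8) p.558] -/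
theorem w1_adm (hA : Adm a i) (y y' : HiggsLattice.Site P (i.j + 1)) (hy' : y' ∈ i.L2p) (hy'' : y' ∉ i.L2p \ i.L5) :
    i.w1 y ≤ (HiggsLattice.Site.tdist y y' : ℝ) := by
  unfold w1
  split_ifs with h
  · have h5 : y' ∈ i.L5 := by
      by_contra h5
      exact hy'' (Finset.mem_sdiff.2 ⟨hy', h5⟩)
    exact hA.sep45 y h.1 h.2 y' h5
  · exact Nat.cast_nonneg _

/-- `w2` is an admissible weight for the pair `Λ₂^{(k)} ⊆ Λ₂′`. [cite: Balaban1982Higgs2, (2.8) p.558] -/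
theorem w2_adm (hA : Adm a i) (y y' : HiggsLattice.Site P (i.j + 1)) (hy' : y' ∈ i.L2p) (hy'' : y' ∉ i.L2k) :
    i.w2 y ≤ (HiggsLattice.Site.tdist y y' : ℝ) := by
  unfold w2
  split_ifs with h
  · exact hA.sep2k y h y' hy' hy''
  · exact Nat.cast_nonneg _

/-- `w1 = r` on `Λ₆′ ∖ Λ₄`. [cite: Balaban1982Higgs2, (2.8) p.558] -/
theorem w1_eq {y : HiggsLattice.Site P (i.j + 1)} (hy : y ∈ i.L6) (hy4 : y ∉ i.L4) : i.w1 y = i.r := by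
  simp [w1, hy, hy4]

/-- `w2 = r` on `Λ₃^{(k)}`. [cite: Balaban1982Higgs2, (2.8) p.558] -/
theorem w2_eq {y : HiggsLattice.Site P (i.j + 1)} (hy : y ∈ i.L3) : i.w2 y = i.r := by
  simp [w2, hy]

/-- **(2.109), FIRST INEQUALITY — POINTWISE, EXPLICIT, for the concrete `Δ^{(k),Lᵏε}(Ω,B̃)` of the (Higgs)₂,₃ carrier at a regular
field.**  For `a > 0`, `L > 1`, every admissible step (`Adm`) and every `δ ≥ 0` with `(4d + 4a)δ ≤ γ₀`:
`|h_k(x,x′)| ≤ (c₀^{(2.27)} + c₀^{(2.29)})(Lᵏε)⁻² e^{−(δ/2) r} e^{−(δ/2)|x − x′|}` for all `x, x′ ∈ Λ₆^{(k−1)′}` (matrix elements of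
`H_k`, `|x − x′|` = torus distance of the `k`-sites).  Route = p. 580 «using Proposition I.2.2»: blocks `P×P`, `P×(Λ₃∖Λ₄)`,
`(Λ₃∖Λ₄)×P` by (I.2.29) for the pair `Ω₁ ⊆ Ω` (r14 `ineq229_regular_region`, weight `w1`), `P×Λ₄`, `Λ₄×P` by (I.2.27) on `Ω` at
separation `≥ r` (r14 `ineq227_regular_region_uniform`), `Λ₃×Λ₃` by (I.2.29) for `Ω₂ ⊆ Ω` (weight `w2`).
[cite: Balaban1982Higgs2, (2.109) p.580; Balaban1982Higgs1, Prop. 2.2 (2.27)–(2.29) p.611] -/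
theorem abs_hk_le (ha : 0 < a) (hL : 1 < P.L) (hA : Adm a i) {δ : ℝ} (hδ0 : 0 ≤ δ)
    (hδ : (4 * P.d + 4 * a) * δ ≤ gam P.L a) (p q : ↥i.L6 × Ix N) :
    |i.hk a p q| ≤ (c227 P.L a δ + c229 P.d P.L a δ) * (P.mesh (i.j + 1))⁻¹ ^ 2 *
      Real.exp (-(δ / 2 * i.r)) * Real.exp (-(δ / 2 * (HiggsLattice.Site.tdist p.1.1 q.1.1 : ℝ))) := by
  have hγ : 0 < gam P.L a := gam_pos hL ha
  have hδ' : (4 * P.d + 4 * a) * δ ≤ min 2 (a * (1 - ((P.L : ℝ) ^ 2)⁻¹) / 4) := hδ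
  have hM : 0 < (P.mesh (i.j + 1))⁻¹ ^ 2 := by
    have := P.mesh_pos (i.j + 1)
    positivity
  have h227 : 0 ≤ c227 P.L a δ := c227_nonneg hL ha δ
  have h229 : 0 ≤ c229 P.d P.L a δ := c229_nonneg P.d hL ha δ
  have hD : 0 ≤ (HiggsLattice.Site.tdist p.1.1 q.1.1 : ℝ) := Nat.cast_nonneg _
  -- the region dictionaries `x ∈ Bᵏ(S) ↔ x_k ∈ S`
  have hΩ : ∀ x, x ∈ i.Ω ↔ blockIter (i.j + 1) x ∈ i.L2p := i.mem_reg i.L2p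
  have hΩ₁ : ∀ x, x ∈ i.Ω₁ ↔ blockIter (i.j + 1) x ∈ i.L2p \ i.L5 := i.mem_reg _
  have hΩ₂ : ∀ x, x ∈ i.Ω₂ ↔ blockIter (i.j + 1) x ∈ i.L2k := i.mem_reg _
  have hc229 : a ^ 2 * ((Real.exp (6 * δ) * ((P.d + a / 2) * (2 / min 2 (a * (1 - ((P.L : ℝ) ^ 2)⁻¹) / 4)) ^ 2
        + (min 2 (a * (1 - ((P.L : ℝ) ^ 2)⁻¹) / 4))⁻¹)
        + 4 / min 2 (a * (1 - ((P.L : ℝ) ^ 2)⁻¹) / 4) * Real.exp δ) / 2) = c229 P.d P.L a δ := by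
    unfold c229 gam; ring
  have hc227 : (P.mesh (i.j + 1))⁻¹ ^ 2 * (a + a ^ 2 * (2 / min 2 (a * (1 - ((P.L : ℝ) ^ 2)⁻¹) / 4) * Real.exp δ))
      = c227 P.L a δ * (P.mesh (i.j + 1))⁻¹ ^ 2 := by
    unfold c227 gam; ring
  -- the target bound dominates each of the two constituent bounds
  have hdom229 : ∀ {E : ℝ}, 0 ≤ E →
      c229 P.d P.L a δ * (P.mesh (i.j + 1))⁻¹ ^ 2 * (Real.exp (-(δ / 2 * i.r)) * Real.exp (-(δ / 2 * E))) ≤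
        (c227 P.L a δ + c229 P.d P.L a δ) * (P.mesh (i.j + 1))⁻¹ ^ 2 * Real.exp (-(δ / 2 * i.r)) *
          Real.exp (-(δ / 2 * E)) := by
    intro E _
    have hx : 0 ≤ (P.mesh (i.j + 1))⁻¹ ^ 2 * (Real.exp (-(δ / 2 * i.r)) * Real.exp (-(δ / 2 * E))) := by positivity
    nlinarith [mul_nonneg h227 hx]
  have hdom227 : ∀ {E : ℝ}, 0 ≤ E →
      c227 P.L a δ * (P.mesh (i.j + 1))⁻¹ ^ 2 * (Real.exp (-(δ / 2 * i.r)) * Real.exp (-(δ / 2 * E))) ≤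
        (c227 P.L a δ + c229 P.d P.L a δ) * (P.mesh (i.j + 1))⁻¹ ^ 2 * Real.exp (-(δ / 2 * i.r)) *
          Real.exp (-(δ / 2 * E)) := by
    intro E _
    have hx : 0 ≤ (P.mesh (i.j + 1))⁻¹ ^ 2 * (Real.exp (-(δ / 2 * i.r)) * Real.exp (-(δ / 2 * E))) := by positivity
    nlinarith [mul_nonneg h229 hx]
  -- (I.2.29) for the pair `Ω₁ ⊆ Ω` at two points of `Λ₆′ ∖ Λ₄`
  have case1 : ∀ {p q : ↥i.L6 × Ix N}, p.1.1 ∉ i.L4 → q.1.1 ∉ i.L4 → i.hk a p q = i.DΩ a p q - i.D1 a p q →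
      |i.hk a p q| ≤ (c227 P.L a δ + c229 P.d P.L a δ) * (P.mesh (i.j + 1))⁻¹ ^ 2 *
        Real.exp (-(δ / 2 * i.r)) * Real.exp (-(δ / 2 * (HiggsLattice.Site.tdist p.1.1 q.1.1 : ℝ))) := by
    intro p q hp4 hq4 hform
    have hp5 : p.1.1 ∈ i.L2p \ i.L5 := Finset.mem_sdiff.2 ⟨i.h6 p.1.2, fun h => hp4 (i.h54 h)⟩
    have hq5 : q.1.1 ∈ i.L2p \ i.L5 := Finset.mem_sdiff.2 ⟨i.h6 q.1.2, fun h => hq4 (i.h54 h)⟩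
    have h := ineq229_regular_region i.C ha hL i.hmsq i.j i.hjK i.Ω₁ i.Ω (i.L2p \ i.L5) i.L2p hΩ₁ hΩ Finset.sdiff_subset
      i.A hA.reg hA.small hδ0 hδ' i.w1 (fun y y' hy' hy'' => w1_adm hA y y' hy' hy'') (p.1.1, p.2) (q.1.1, q.2) hp5 hq5
    dsimp only at h
    rw [w1_eq p.1.2 hp4, w1_eq q.1.2 hq4, hc229] at h
    rw [hform, abs_sub_comm]
    calc |i.D1 a p q - i.DΩ a p q|
        ≤ c229 P.d P.L a δ * (P.mesh (i.j + 1))⁻¹ ^ 2 *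
            Real.exp (-(δ / 2 * ((HiggsLattice.Site.tdist p.1.1 q.1.1 : ℝ) + i.r + i.r))) := h
      _ ≤ c229 P.d P.L a δ * (P.mesh (i.j + 1))⁻¹ ^ 2 *
            (Real.exp (-(δ / 2 * i.r)) * Real.exp (-(δ / 2 * (HiggsLattice.Site.tdist p.1.1 q.1.1 : ℝ)))) :=
          mul_le_mul_of_nonneg_left (damped_le hδ0 hA.hr) (mul_nonneg h229 hM.le)
      _ ≤ _ := hdom229 (Nat.cast_nonneg _)
  -- (I.2.27) on `Ω` at separation `≥ r`
  have caseFar : ∀ {p q : ↥i.L6 × Ix N}, i.r ≤ (HiggsLattice.Site.tdist p.1.1 q.1.1 : ℝ) → i.hk a p q = i.DΩ a p q →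
      |i.hk a p q| ≤ (c227 P.L a δ + c229 P.d P.L a δ) * (P.mesh (i.j + 1))⁻¹ ^ 2 *
        Real.exp (-(δ / 2 * i.r)) * Real.exp (-(δ / 2 * (HiggsLattice.Site.tdist p.1.1 q.1.1 : ℝ))) := by
    intro p q hfar hform
    have h := ineq227_regular_region_uniform i.C ha hL i.hmsq i.j i.hjK i.Ω i.L2p hΩ i.A hA.reg hA.small hδ0 hδ'
      (p.1.1, p.2) (q.1.1, q.2) (i.h6 p.1.2) (i.h6 q.1.2)
    dsimp only at h
    rw [hc227] at h
    rw [hform]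
    calc |i.DΩ a p q|
        ≤ c227 P.L a δ * (P.mesh (i.j + 1))⁻¹ ^ 2 *
            Real.exp (-(δ * (HiggsLattice.Site.tdist p.1.1 q.1.1 : ℝ))) := h
      _ ≤ c227 P.L a δ * (P.mesh (i.j + 1))⁻¹ ^ 2 *
            (Real.exp (-(δ / 2 * i.r)) * Real.exp (-(δ / 2 * (HiggsLattice.Site.tdist p.1.1 q.1.1 : ℝ)))) :=
          mul_le_mul_of_nonneg_left (far_le hδ0 hfar) (mul_nonneg h227 hM.le)
      _ ≤ _ := hdom227 (Nat.cast_nonneg _)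
  by_cases hp3 : p.1.1 ∈ i.L3 <;> by_cases hq3 : q.1.1 ∈ i.L3
  · -- `Λ₃ × Λ₃`: `δΔ(Ω₂ ⊆ Ω)`
    have h := ineq229_regular_region i.C ha hL i.hmsq i.j i.hjK i.Ω₂ i.Ω i.L2k i.L2p hΩ₂ hΩ i.h2k
      i.A hA.reg hA.small hδ0 hδ' i.w2 (fun y y' hy' hy'' => w2_adm hA y y' hy' hy'') (p.1.1, p.2) (q.1.1, q.2)
      (i.h32 hp3) (i.h32 hq3)
    dsimp only at h
    rw [w2_eq hp3, w2_eq hq3, hc229] at h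
    rw [hk_33 hp3 hq3, abs_sub_comm]
    calc |i.D2 a p q - i.DΩ a p q|
        ≤ c229 P.d P.L a δ * (P.mesh (i.j + 1))⁻¹ ^ 2 *
            Real.exp (-(δ / 2 * ((HiggsLattice.Site.tdist p.1.1 q.1.1 : ℝ) + i.r + i.r))) := h
      _ ≤ c229 P.d P.L a δ * (P.mesh (i.j + 1))⁻¹ ^ 2 *
            (Real.exp (-(δ / 2 * i.r)) * Real.exp (-(δ / 2 * (HiggsLattice.Site.tdist p.1.1 q.1.1 : ℝ)))) :=
          mul_le_mul_of_nonneg_left (damped_le hδ0 hA.hr) (mul_nonneg h229 hM.le)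
      _ ≤ _ := hdom229 hD
  · -- `Λ₃ × P`
    by_cases hp4 : p.1.1 ∈ i.L4
    · refine caseFar ?_ (hk_4P hp4 hq3)
      rw [tdist_comm]
      exact hA.sep34 q.1.1 q.1.2 hq3 p.1.1 hp4
    · exact case1 hp4 (fun h => hq3 (i.h43 h)) (hk_34P hp3 hp4 hq3)
  · -- `P × Λ₃`
    by_cases hq4 : q.1.1 ∈ i.L4
    · exact caseFar (hA.sep34 p.1.1 p.1.2 hp3 q.1.1 hq4) (hk_P4 hp3 hq4)
    · exact case1 (fun h => hp3 (i.h43 h)) hq4 (hk_P34 hp3 hq3 hq4)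
  · -- `P × P`
    exact case1 (fun h => hp3 (i.h43 h)) (fun h => hq3 (i.h43 h)) (hk_PP hp3 hq3)

/-- **(2.109)₁ in the printed UNIT-LATTICE currency** ((I.2.22)): `|(Lᵏε)²h_k(x,x′)| ≤ (c₀^{(2.27)} + c₀^{(2.29)})e^{−(δ/2)r}
e^{−(δ/2)|x−x′|}` — an `ε`-free, volume-free, `k`-free constant. [cite: Balaban1982Higgs2, (2.109) p.580; Balaban1982Higgs1, (2.22) p.610] -/
theorem abs_hkUnit_le (ha : 0 < a) (hL : 1 < P.L) (hA : Adm a i) {δ : ℝ} (hδ0 : 0 ≤ δ)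
    (hδ : (4 * P.d + 4 * a) * δ ≤ gam P.L a) (p q : ↥i.L6 × Ix N) :
    |i.hkUnit a p q| ≤ (c227 P.L a δ + c229 P.d P.L a δ) *
      Real.exp (-(δ / 2 * i.r)) * Real.exp (-(δ / 2 * (HiggsLattice.Site.tdist p.1.1 q.1.1 : ℝ))) := by
  have hm : 0 < P.mesh (i.j + 1) := P.mesh_pos (i.j + 1)
  have h := abs_hk_le ha hL hA hδ0 hδ p q
  rw [hkUnit, abs_mul, abs_of_pos (pow_pos hm 2)]
  calc P.mesh (i.j + 1) ^ 2 * |i.hk a p q|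
      ≤ P.mesh (i.j + 1) ^ 2 * ((c227 P.L a δ + c229 P.d P.L a δ) * (P.mesh (i.j + 1))⁻¹ ^ 2 *
          Real.exp (-(δ / 2 * i.r)) * Real.exp (-(δ / 2 * (HiggsLattice.Site.tdist p.1.1 q.1.1 : ℝ)))) :=
        mul_le_mul_of_nonneg_left h (sq_nonneg _)
    _ = _ := by field_simp

end Inst

/-! ## §4 The printed quantifier shape; the row's decl `B2Sect2Statements.Ineq2109`; r14's twin; the second inequality -/

/-- **(2.109), FIRST INEQUALITY, IN THE PRINTED QUANTIFIER SHAPE on the (Higgs)₂,₃ carrier**: for every `d`, `L > 1`, `a > 0` there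
are `C, δ₀, δ₁ > 0` (functions of `d, L, a` only — *"O(1)"*, `δ₀`, `δ₁` of (2.109)) such that for EVERY torus of the model with
these `d, L` (every volume, `ε`, `K`), every `N`, charge data, mass `m² > 0`, level `1 ≤ k ≤ K`, every system of sets
`Λ₂^{(k−1)′} ⊇ Λ₆^{(k−1)′} ⊇ Λ₃^{(k)} ⊇ Λ₄^{(k)} ⊇ Λ₅^{(k)}`, `Λ₃^{(k)} ⊆ Λ₂^{(k)} ⊆ Λ₂^{(k−1)′}` with the (2.8) separations `≥ r`,
EVERY field `B̃` regular on `Ω = Bᵏ(Λ₂^{(k−1)′})` below r14's coupling threshold: `|h_k(x,x′)| ≤ C(Lᵏε)⁻²e^{−δ₁r}e^{−δ₀|x − x′|}`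
on `Λ₆^{(k−1)′}`. [cite: Balaban1982Higgs2, (2.109) p.580] -/
theorem ineq2109_higgsLattice_explicit (d L : ℕ) (hL : 1 < L) {a : ℝ} (ha : 0 < a) :
    ∃ C δ₀ δ₁ : ℝ, 0 < C ∧ 0 < δ₀ ∧ 0 < δ₁ ∧
      ∀ (P : HiggsLattice.Params), P.d = d → P.L = L → ∀ (N : ℕ) (i : Inst P N), Adm a i →
        ∀ p q : ↥i.L6 × Ix N,
          |i.hk a p q| ≤ C * (P.mesh (i.j + 1))⁻¹ ^ 2 * Real.exp (-(δ₁ * i.r)) *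
            Real.exp (-(δ₀ * (HiggsLattice.Site.tdist p.1.1 q.1.1 : ℝ))) := by
  have hγ : 0 < gam L a := gam_pos hL ha
  have hden : (0 : ℝ) < 4 * d + 4 * a := by positivity
  set δ := gam L a / (4 * d + 4 * a) with hδdef
  have hδ0 : 0 < δ := div_pos hγ hden
  refine ⟨c227 L a δ + c229 d L a δ + 1, δ / 2, δ / 2,
    by linarith [c227_nonneg hL ha δ, c229_nonneg d hL ha δ], by positivity, by positivity, ?_⟩
  intro P hPd hPL N i hA p q
  subst hPd hPL
  have hδ' : (4 * P.d + 4 * a) * δ ≤ gam P.L a := by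
    rw [hδdef, mul_div_cancel₀ _ hden.ne']
  have h := Inst.abs_hk_le ha hL hA hδ0.le hδ' p q
  refine h.trans ?_
  have hM : 0 ≤ (P.mesh (i.j + 1))⁻¹ ^ 2 := sq_nonneg _
  have hE : 0 ≤ (P.mesh (i.j + 1))⁻¹ ^ 2 * Real.exp (-(δ / 2 * i.r)) *
      Real.exp (-(δ / 2 * (HiggsLattice.Site.tdist p.1.1 q.1.1 : ℝ))) := by positivity
  nlinarith [hE]

/-- the admissible carrier instances with fixed `(d, L, a)` (the index type of the family). [cite: Balaban1982Higgs2, (2.109) p.580] -/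
structure AdmIdx (d L : ℕ) (a : ℝ) where
  P : HiggsLattice.Params
  hd : P.d = d
  hL : P.L = L
  N : ℕ
  i : Inst P N
  adm : Adm a i

/-- **ROW B2.Eq2.109 — `B2Sect2Statements.Ineq2109` INHABITED ON THE (Higgs)₂,₃ CARRIER** for the family of all admissible
instances with fixed `(d, L > 1, a > 0)` (index = torus of the model with these `d, L` + `N` + charge + mass + level + sets +
regular field; `X = Λ₆^{(k−1)′} × {1,…,N}`; `h` = the matrix elements of `H_k` in the unit-lattice currency `(Lᵏε)²h_k`;
`dist` = the torus distance (I.1.3) of the `k`-sites; `r` = `r(Lᵏε)`): *"∃ O(1), δ₀, δ₁ > 0: |h_k(x,x′)| ≤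
O(1)exp(−δ₁r(Lᵏε))exp(−δ₀|x − x′|) for x, x′ ∈ Λ₆^{(k−1)′}"*. [cite: Balaban1982Higgs2, (2.109) p.580] -/
theorem ineq2109_higgsLattice (d L : ℕ) (hL : 1 < L) {a : ℝ} (ha : 0 < a) :
    B2Sect2Statements.Ineq2109 (fun ι : AdmIdx d L a => ↥ι.i.L6 × Ix ι.N)
      (fun ι p q => ι.i.hkUnit a p q)
      (fun _ p q => (HiggsLattice.Site.tdist p.1.1 q.1.1 : ℝ)) (fun ι => ι.i.r) := by
  obtain ⟨C, δ₀, δ₁, -, hδ₀, hδ₁, h⟩ := ineq2109_higgsLattice_explicit d L hL ha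
  refine ⟨C, δ₀, δ₁, hδ₀, hδ₁, fun ι p q => ?_⟩
  have hm : 0 < ι.P.mesh (ι.i.j + 1) := ι.P.mesh_pos _
  have h1 := h ι.P ι.hd ι.hL ι.N ι.i ι.adm p q
  show |ι.i.hkUnit a p q| ≤ _
  rw [Inst.hkUnit, abs_mul, abs_of_pos (pow_pos hm 2)]
  calc ι.P.mesh (ι.i.j + 1) ^ 2 * |ι.i.hk a p q|
      ≤ ι.P.mesh (ι.i.j + 1) ^ 2 * (C * (ι.P.mesh (ι.i.j + 1))⁻¹ ^ 2 * Real.exp (-(δ₁ * ι.i.r)) *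
          Real.exp (-(δ₀ * (HiggsLattice.Site.tdist p.1.1 q.1.1 : ℝ)))) :=
        mul_le_mul_of_nonneg_left h1 (sq_nonneg _)
    _ = C * Real.exp (-(δ₁ * ι.i.r)) * Real.exp (-(δ₀ * (HiggsLattice.Site.tdist p.1.1 q.1.1 : ℝ))) := by
        field_simp

/-- r14's twin of the first inequality, `B2StepK.KernelBound2109`, for every admissible carrier instance, with ONE `(C, δ₁, δ₀)`
per `(d, L, a)` (kernel in `Lᵏε`-units: the constant carries `(Lᵏε)⁻²`). [cite: Balaban1982Higgs2, (2.109) p.580] -/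
theorem kernelBound2109_higgsLattice (d L : ℕ) (hL : 1 < L) {a : ℝ} (ha : 0 < a) :
    ∃ C δ₀ δ₁ : ℝ, 0 < C ∧ 0 < δ₀ ∧ 0 < δ₁ ∧
      ∀ (P : HiggsLattice.Params), P.d = d → P.L = L → ∀ (N : ℕ) (i : Inst P N), Adm a i →
        B2StepK.KernelBound2109 (i.hk a) (fun p q => (HiggsLattice.Site.tdist p.1.1 q.1.1 : ℝ))
          (C * (P.mesh (i.j + 1))⁻¹ ^ 2) δ₁ δ₀ i.r := by
  obtain ⟨C, δ₀, δ₁, hC, hδ₀, hδ₁, h⟩ := ineq2109_higgsLattice_explicit d L hL ha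
  exact ⟨C, δ₀, δ₁, hC, hδ₀, hδ₁, fun P hd hL' N i hA p q => h P hd hL' N i hA p q⟩

/-- **(2.109), SECOND INEQUALITY** *"≤ O((Lᵏε)^κ)exp(−δ₀|x − x′|) … for … arbitrary κ"* for the concrete `H_k` of the carrier: when
the instance's `r` is the printed `r(Lᵏε) = R(1 + log(Lᵏε)⁻¹)^r` of (2.7) with the printed ranges (`B2.Params.Printed`) and
`0 < Lᵏε ≤ 1`, then for every `κ`, `|(Lᵏε)²h_k(x,x′)| ≤ C′(Lᵏε)^κ e^{−δ₀|x−x′|}` — by r14's `B2StepK.kernelBound2109_pow_of_printed`.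
[cite: Balaban1982Higgs2, (2.109) p.580, (2.7) p.558] -/
theorem ineq2109_pow_higgsLattice (d L : ℕ) (hL : 1 < L) {a : ℝ} (ha : 0 < a) (Q : B2.Params) (hQ : Q.Printed) :
    ∃ δ₀ : ℝ, 0 < δ₀ ∧ ∀ (P : HiggsLattice.Params), P.d = d → P.L = L → ∀ (N : ℕ) (i : Inst P N), Adm a i →
      0 < P.mesh (i.j + 1) → P.mesh (i.j + 1) ≤ 1 → i.r = B2.rFn Q.R Q.r (P.mesh (i.j + 1)) →
        ∀ κ : ℝ, ∃ C' : ℝ, ∀ p q : ↥i.L6 × Ix N,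
          |i.hkUnit a p q| ≤ C' * P.mesh (i.j + 1) ^ κ * Real.exp (-(δ₀ * (HiggsLattice.Site.tdist p.1.1 q.1.1 : ℝ))) := by
  obtain ⟨C, δ₀, δ₁, hδ₀, hδ₁, h⟩ := ineq2109_higgsLattice d L hL ha
  refine ⟨δ₀, hδ₀, fun P hd hL' N i hA hs hs1 hr κ => ?_⟩
  have hk : B2StepK.KernelBound2109 (i.hkUnit a) (fun p q => (HiggsLattice.Site.tdist p.1.1 q.1.1 : ℝ))
      (max C 0) δ₁ δ₀ (B2.rFn Q.R Q.r (P.mesh (i.j + 1))) := by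
    intro p q
    have h1 := h ⟨P, hd, hL', N, i, hA⟩ p q
    rw [← hr]
    refine h1.trans (mul_le_mul_of_nonneg_right (mul_le_mul_of_nonneg_right (le_max_left C 0) (Real.exp_pos _).le)
      (Real.exp_pos _).le)
  exact B2StepK.kernelBound2109_pow_of_printed Q hQ (le_max_right C 0) hδ₁ hk hs hs1 κ

/-! ## §5 (3.8) ⇒ (3.12) for THIS `H_k` on the torus; non-vacuity -/

section Norm

open scoped Matrix.Norms.L2Operator

/-- the index set `Λ₆^{(k−1)′} × {1,…,N}` embeds in `T^{(k)} × Fin N` (sites and internal index). [cite: Balaban1982Higgs2, (3.12) p.586] -/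
theorem emb_injective (i : Inst P N) :
    Function.Injective (fun p : ↥i.L6 × Ix N => ((p.1.1, p.2) : HiggsLattice.Site P (i.j + 1) × Fin (Module.finrank ℝ (E N)))) := by
  intro p q h
  simp only [Prod.mk.injEq] at h
  exact Prod.ext (Subtype.ext h.1) h.2

/-- **(3.8) ⇒ (3.12) FOR THE CONCRETE `H_k`** (p. 586: *"The property (3.8) implies in turn the following estimates for the norms
… in L²: ‖H′_k‖, ‖H″_k‖ ≦ O(1)exp(−δ₁r(Lᵏε))"*): for every `d`, `L > 1`, `a > 0` there are `C, δ₀, δ₁ > 0` such that for every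
admissible carrier instance the `ℓ² → ℓ²` operator norm of `H_k` on `Λ₆^{(k−1)′} × {1,…,N}` is
`≤ C(Lᵏε)⁻²·(N·K_d(δ₀))·e^{−δ₁r}` — r02's `B2Ineq312OperatorNorm.norm312_le` (Schur test + the volume-uniform torus sums
`K_d = B4Sect5Proof.latticeConst`) fed with §4. [cite: Balaban1982Higgs2, (3.12) p.586, (3.8) p.584, (2.109) p.580] -/
theorem norm_Hk_le (d L : ℕ) (hL : 1 < L) {a : ℝ} (ha : 0 < a) :
    ∃ C δ₀ δ₁ : ℝ, 0 < C ∧ 0 < δ₀ ∧ 0 < δ₁ ∧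
      ∀ (P : HiggsLattice.Params), P.d = d → P.L = L → ∀ (N : ℕ) (i : Inst P N), Adm a i →
        ‖i.Hk a‖ ≤ C * (P.mesh (i.j + 1))⁻¹ ^ 2 *
          (((Module.finrank ℝ (E N) : ℕ) : ℝ) * B4Sect5Proof.latticeConst P.d δ₀) * Real.exp (-(δ₁ * i.r)) := by
  obtain ⟨C, δ₀, δ₁, hC, hδ₀, hδ₁, h⟩ := kernelBound2109_higgsLattice d L hL ha
  refine ⟨C, δ₀, δ₁, hC, hδ₀, hδ₁, fun P hd hL' N i hA => ?_⟩
  have hC' : 0 ≤ C * (P.mesh (i.j + 1))⁻¹ ^ 2 := by positivity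
  exact B2Ineq312OperatorNorm.norm312_le _ (emb_injective i) (i.Hk a) hC' hδ₀ (h P hd hL' N i hA)

end Norm

/-- **Non-vacuity of the admissible family**: on every torus of the model with `K ≥ 1`, for every charge, mass `m² > 0` and
`r ≥ 0`, the zero field `B̃ = 0` with `Λ₂^{(k−1)′} = Λ₆^{(k−1)′} = Λ₂^{(k)} = T^{(k)}` and `Λ₃ = Λ₄ = Λ₅ = ∅` is an admissible
instance at level `k = 1` (regularity modulus `δ_A = 0`; the separations are void). [cite: Balaban1982Higgs2, (2.108) p.580] -/
theorem adm_nonvacuous (hK : 1 ≤ P.K) (C : ChargeData N) {msq : ℝ} (hmsq : 0 < msq) {r : ℝ} (hr : 0 ≤ r) (a : ℝ) :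
    ∃ i : Inst P N, i.j = 0 ∧ i.r = r ∧ Adm a i := by
  let i₀ : Inst P N :=
    ⟨0, hK, C, 0, msq, hmsq, 0, Finset.univ, Finset.univ, ∅, ∅, ∅, Finset.univ,
      subset_rfl, Finset.empty_subset _, subset_rfl, subset_rfl, Finset.empty_subset _, subset_rfl, r⟩
  refine ⟨i₀, rfl, rfl, ?_, ?_, hr, ?_, ?_, ?_⟩
  · intro z _ μ ν
    simp [i₀]
  · norm_num [i₀]
  · intro y _ _ u hu
    simp [i₀] at hu
  · intro y _ _ u hu
    simp [i₀] at hu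
  · intro y hy
    simp [i₀] at hy

end Literature.MathematicalPhysics.QuantumFieldTheory.Balaban1983to89.B2Ineq2109HiggsLattice

end
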